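import Summits.HodgeConjecture.HodgeConjecture.Theorems.K2E1bDSCellUnitarizable   -- ★ U8-4 brick: `dsCellDatum_isUnitarizable` (over ★ U8-3 `K2E1bDSCellData`∕`…Laws`: `dsCellDatum`, `_isIrreducible`, `_casimir`, `_integral`)
import Summits.HodgeConjecture.HodgeConjecture.Theorems.K2E1bCarriersOfRecord      -- ★ #23 (K2E1b-p13): `σOfRecord`, `ρKOfRecord`, `isGKModule_ofRecord`, `isIrreducibleGK_ofRecord`, `isCohUnitaryIrrep_ofRecord`, `hasChiScalars_ofRecord`, `dsInfOfRecord`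
import HarnessLib

/-!
# K2 ∕ E1b unit U8, row U8-4 (Deal Q9c) `K2E1bDSClsOfRecord`: the CLASSES OF RECORD `dsClsOfRecord a b c j` of the discrete-series packet
# `Π(φ(a,b,c)) = {D_φ, D_φ⁺, D_φ⁻}` of `U(2,1)`, the carrier table `dsCarriersOfRecord : DSPacketCarriers`, and its law `LawChi`

HCML Track B «K2-LIT», cell `hodgecm-mathlib`, crux H413 = stmt-HodgeConjecture-24833 (supports-only helper; closes nothing by itself).  Row U8-4
`K2E1bDSCellUnitary` of the TABLE `Lines/K2_E1b_GKCohomologyU21_U8_ArchPacketSigns.md` (ED. 7): «`dsCellDatum_cohUnitary` …; then `def dsClsOfRecord a b c j :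
GKIrrClass U(2,1)`, `LawDistinct`, `LawChi`; `LawGlob` via ★ letter `HasUnitaryGlobalizationOfInfUnitary`» — DEAL Q9c of K2E1b-plan (g3) 2026-09-04T01:55:59Z
(«`dsClsOfRecord` … keep the def TOTAL and junk-documented … `dsCarriersOfRecord : DSPacketCarriers := ⟨…⟩` + `lawChi_dsCarriersOfRecord`»), chair K2-lead (g0)
02:03:36Z; hand K2E4-p10 (g2).  DEFINITIONS WITH BODY + proved theorems; no `sorry`, no named `Prop` fact, no instance (one `attribute [local instance]
LieRing.ofAssociativeRing`, the idiom of ★ `K2E1bCarriersOfRecord` and every ★ Kovačević file), no notation.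

## The construction (★ #23's «structure of record», applied to the three cell data)

For a Kovačević datum `𝒟` and an integer `e`, ★ `K2E1bCarriersOfRecord` builds the `(𝔲(2,1), K)`-STRUCTURE OF RECORD on `𝒟.V`: the twisted `K`-action
★ `ρKOfRecord 𝒟 e = kTypeRepTw 𝒟.S e` and the central twist ★ `σOfRecord 𝒟 e = kovLie 𝒟.ρ + (e∕3)·tr(·)·1`; it is a `(𝔤,K)`-module when `𝒟` is integral
at `e` (★ `isGKModule_ofRecord`), irreducible when `𝒟` is (★ `isIrreducibleGK_ofRecord`), coh-unitary irreducible when `𝒟` is moreover unitarizable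
(★ `isCohUnitaryIrrep_ofRecord`), with χ-scalars `(κ, e)` when `Σ E_{ij}E_{ji}` acts on `𝒟` by `κ − e²∕3` (★ `hasChiScalars_ofRecord`).  Here `𝒟 := dsCellDatum j a b c`
(★ U8-3) and `e := centralOf a b c = a + b + c`, `κ := casimirOf a b c = a² + b² + c² − 2`; the four inputs are ★ U8-3 ∕ U8-4-brick:
`dsCellDatum_integral` (integrality `6 ∣ m − 3n + 3 + 2e`), `dsCellDatum_isIrreducible`, `dsCellDatum_isUnitarizable` (p856702), and `dsCellDatum_casimir`
(`Ω = (κ − e²∕3) • 1`) read through ★ `K2E1bDsDatum.sum_lie_lie_eq_casimir`.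

* §1 **`dsCellRep a b c j h : GKIrrep G21`** (`h : IsRegularParam a b c`) — the irreducible `(𝔲(2,1), K)`-module of record on the cell `dsCellDatum j a b c`;
  `dsCellRep_package h j : IsCohUnitaryIrrep … ∧ HasChiScalars … (casimirOf a b c) (centralOf a b c)`.
* §2 **`dsClsOfRecord (a b c : ℤ) (j : Fin 3) : GKIrrClass G21`** — TOTAL: `GKIrrClass.mk (dsCellRep a b c j h)` when `b + 2 ≤ a ∧ c + 2 ≤ b` (= `IsRegularParam a b c`,
  definitionally), and the JUNK VALUE ★ `K2E1bCarriersOfRecord.dsInfOfRecord 0 0 0` otherwise (documented; no law is ever asked outside `IsRegularParam`);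
  `dsClsOfRecord_of_regular` ∕ `dsClsOfRecord_of_not_regular`; **`dsCarriersOfRecord : DSPacketCarriers := ⟨dsClsOfRecord⟩`** — an INHABITANT BY NAME of the
  posited carrier table ★ `DSPacketCarriers` (U8-0), index `0 ↦ D_φ`, `1 ↦ D_φ⁺`, `2 ↦ D_φ⁻`.
* §3 **`lawChi_dsCarriersOfRecord : dsCarriersOfRecord.LawChi`** — each member is χ-pinned coh-unitary at `(κ, e)(a,b,c)` (★ `IsChiPinnedCohUnitary`).
`LawDistinct` (the three classes are distinct: different `K`-type sets ∕ vertices) and `LawGlob` (via the A-letter ★ `HasUnitaryGlobalizationOfInfUnitary`) are the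
dealer's next cuts (TABLE ED. 7 row U8-4 ∕ §2c LEVEL-B′) and are NOT asserted here.

Sources: [Rogawski1990] §12.3 pp. 176–178 (the packets `{D_φ, D_φ⁺, D_φ⁻}`, `χ_φ`); [Kovacevic2021] §3 Thm 3, §4 Thm 4–5, §6; [BorelWallach2000] 0 §2.5, VI §4
4.7–4.12; [KnappVogan1995] Prop. 4.120 (infinitesimal character under tensoring by a character).  HONEST LABEL: HC_CM is proved only modulo the 7 printed
citations (2 remaining named inputs: hLiu418 = stmt-HodgeConjecture-24832, h413 = stmt-HodgeConjecture-24833) until rung 0 closes; a carrier table with one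
law closes nothing by itself (`sig_K2E1bArchPacketSigns` needs all four laws + pseudo-coefficients).
-/

set_option autoImplicit false
set_option linter.dupNamespace false

noncomputable section

open Literature.NumberTheory.Automorphic
open Literature.RepresentationTheory
open Literature.RepresentationTheory.KonnoKonno2007 Literature.RepresentationTheory.KonnoKonno2007.RealDualPair
open Literature.RepresentationTheory.Kovacevic2021 Literature.RepresentationTheory.Kovacevic2021.SU21Datum
open Summit.HodgeConjecture.HodgeConjecture.Cruxes.H413.F0P3bLocalAPacketsDefs
open Summit.HodgeConjecture.HodgeConjecture.Cruxes.H413.F0P3bArchDegOnePackage (IsCohUnitaryIrrep)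
open Summit.HodgeConjecture.HodgeConjecture.Cruxes.H413.K2E1bGKCohomologyU21
open Summit.HodgeConjecture.HodgeConjecture.Cruxes.H413.K2E1bGKCohomologyU21.U8
open Summit.HodgeConjecture.HodgeConjecture.Cruxes.H413.K2E1bDsDatum (sum_lie_lie_eq_casimir)
open Summit.HodgeConjecture.HodgeConjecture.Cruxes.H413.K2E1bCarriersOfRecord
open Summit.HodgeConjecture.HodgeConjecture.Cruxes.H413.K2E1bDSCellData
open Summit.HodgeConjecture.HodgeConjecture.Cruxes.H413.K2E1bDSCellUnitarizable (dsCellDatum_isUnitarizable)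

namespace Summit.HodgeConjecture.HodgeConjecture.Cruxes.H413.K2E1bDSClsOfRecord

-- Mathlib idiom (as in ★ `K2E1bCarriersOfRecord`, ★ `GKModules`, the ★ defs leaves): `Module.End ℂ V` ∕ matrices as Lie rings by commutators — needed to STATE the
-- bracket spelling `⁅E i j, ⁅E j i, v⁆⁆` and to use `σOfRecord`.
attribute [local instance 100] LieRing.ofAssociativeRing

/-! ## §1 The irreducible `(𝔲(2,1), K)`-module of record on a cell -/

section Regular

variable {a b c : ℤ}

/-- The bracket Casimir `Σ_{ij} ⁅E_{ij}, ⁅E_{ji}, ·⁆⁆` acts on the cell datum `dsCellDatum j a b c` by `κ₀ = casimirOf − centralOf²∕3` (★ `sum_lie_lie_eq_casimir` + ★ U8-3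
`dsCellDatum_casimir`). [cite: Kovacevic2021, §3 Remark 3] [cite: BorelWallach2000, II §2.3] -/
theorem dsCellDatum_sum_lie_lie (j : Fin 3) (v : (dsCellDatum j a b c).V) :
    (∑ i : Fin 3, ∑ i' : Fin 3, ⁅E i i', ⁅E i' i, v⁆⁆) = (((casimirOf a b c : ℤ) : ℂ) - ((centralOf a b c : ℤ) : ℂ) ^ 2 / 3) • v := by
  rw [sum_lie_lie_eq_casimir, dsCellDatum_casimir j, LinearMap.smul_apply, Module.End.one_apply]

/-- **`dsCellRep a b c j h`** — the `j`-th member of `Π(φ(a,b,c))` as an irreducible `(𝔲(2,1), K)`-module: the cell datum `dsCellDatum j a b c` (★ U8-3) with the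
twisted `K`-action ★ `ρKOfRecord · (centralOf a b c)` and the central twist ★ `σOfRecord · (centralOf a b c)` (★ #23's structure of record); a `(𝔤,K)`-module by
integrality (★ `dsCellDatum_integral`), irreducible by ★ `dsCellDatum_isIrreducible`.  `0 ↦ D_φ`, `1 ↦ D_φ⁺`, `2 ↦ D_φ⁻`.
[cite: Rogawski1990, §12.3 pp. 176–178] [cite: BorelWallach2000, 0 §2.5; VI §4 4.7–4.10] [cite: Kovacevic2021, §3 Thm 3, §6] -/
def dsCellRep (a b c : ℤ) (j : Fin 3) (h : IsRegularParam a b c) : GKIrrep G21 :=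
  ⟨(dsCellDatum j a b c).V, ρKOfRecord (dsCellDatum j a b c) (centralOf a b c), σOfRecord (dsCellDatum j a b c) (centralOf a b c),
    isGKModule_ofRecord _ _ (fun _ _ hS => dsCellDatum_integral h j hS),
    isIrreducibleGK_ofRecord _ _ (fun _ _ hS => dsCellDatum_integral h j hS) (dsCellDatum_isIrreducible h j)⟩

/-- **The package of the member of record**: coh-unitary irreducible (★ `isCohUnitaryIrrep_ofRecord` ⟸ integral + irreducible + UNITARIZABLE, ★ U8-4 brick
`dsCellDatum_isUnitarizable`) with χ-scalars `(κ, e) = (casimirOf a b c, centralOf a b c)` (★ `hasChiScalars_ofRecord` ⟸ `dsCellDatum_sum_lie_lie`).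
[cite: Rogawski1990, §12.3 p. 177] [cite: BorelWallach2000, VI Thm. 4.12 (2)] [cite: Kovacevic2021, §4 Thm 4] -/
theorem dsCellRep_package (h : IsRegularParam a b c) (j : Fin 3) :
    IsCohUnitaryIrrep (dsCellRep a b c j h).ρK (dsCellRep a b c j h).ρ𝔤 ∧
      HasChiScalars (dsCellRep a b c j h).ρ𝔤 (casimirOf a b c) (centralOf a b c) :=
  ⟨isCohUnitaryIrrep_ofRecord _ _ (fun _ _ hS => dsCellDatum_integral h j hS) (dsCellDatum_isIrreducible h j) (dsCellDatum_isUnitarizable h j),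
    hasChiScalars_ofRecord _ _ _ (dsCellDatum_sum_lie_lie j)⟩

end Regular

/-! ## §2 The classes of record (TOTAL) and the carrier table -/

/-- **`dsClsOfRecord a b c j`** — the `(𝔤,K)`-CLASS of the `j`-th member of `Π(φ(a,b,c))` (`0 ↦ D_φ`, `1 ↦ D_φ⁺`, `2 ↦ D_φ⁻`): `GKIrrClass.mk (dsCellRep a b c j h)` at a
REGULAR parameter (`b + 2 ≤ a ∧ c + 2 ≤ b`, i.e. ★ `IsRegularParam a b c`, definitionally).  TOTALITY ∕ JUNK: outside `IsRegularParam` the value is the fixed class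
★ `K2E1bCarriersOfRecord.dsInfOfRecord 0 0 0` (an arbitrary but honest class; every law of ★ `DSPacketCarriers` is guarded by `IsRegularParam`, so the junk branch
is never read). [cite: Rogawski1990, §12.3 pp. 176–178] [cite: BorelWallach2000, 0 §2.5] -/
def dsClsOfRecord (a b c : ℤ) (j : Fin 3) : GKIrrClass G21 :=
  if h : b + 2 ≤ a ∧ c + 2 ≤ b then GKIrrClass.mk (dsCellRep a b c j h) else dsInfOfRecord 0 0 0

/-- At a regular parameter `dsClsOfRecord a b c j` is the class of `dsCellRep a b c j h`. [cite: Rogawski1990, §12.3 p. 178] -/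
theorem dsClsOfRecord_of_regular {a b c : ℤ} (h : IsRegularParam a b c) (j : Fin 3) :
    dsClsOfRecord a b c j = GKIrrClass.mk (dsCellRep a b c j h) :=
  dif_pos h

/-- Outside `IsRegularParam` the value is the documented junk class ★ `dsInfOfRecord 0 0 0`. [cite: Rogawski1990, §12.3 p. 178] -/
theorem dsClsOfRecord_of_not_regular {a b c : ℤ} (h : ¬ IsRegularParam a b c) (j : Fin 3) :
    dsClsOfRecord a b c j = dsInfOfRecord 0 0 0 :=
  dif_neg h

/-- **THE CARRIER TABLE OF RECORD** `dsCarriersOfRecord : DSPacketCarriers` — an inhabitant BY NAME of the posited interface ★ `DSPacketCarriers` (leaf U8-0):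
`cls a b c j := dsClsOfRecord a b c j`. [cite: Rogawski1990, §12.3 pp. 176–178] -/
def dsCarriersOfRecord : DSPacketCarriers :=
  ⟨dsClsOfRecord⟩

/-- `dsCarriersOfRecord.cls = dsClsOfRecord` (definitional). [cite: Rogawski1990, §12.3 p. 178] -/
@[simp] theorem dsCarriersOfRecord_cls (a b c : ℤ) (j : Fin 3) : dsCarriersOfRecord.cls a b c j = dsClsOfRecord a b c j := rfl

/-! ## §3 The law `LawChi` -/

/-- **χ-PIN of every member of record**: at a regular parameter, `dsClsOfRecord a b c j` is χ-pinned coh-unitary at `(κ, e) = (casimirOf a b c, centralOf a b c)`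
(★ `IsChiPinnedCohUnitary`; representative = `dsCellRep a b c j h`, §1). [cite: Rogawski1990, §12.3 p. 177] [cite: BorelWallach2000, VI Thm. 4.12 (2)] -/
theorem dsClsOfRecord_chi {a b c : ℤ} (h : IsRegularParam a b c) (j : Fin 3) :
    IsChiPinnedCohUnitary (dsClsOfRecord a b c j) (casimirOf a b c) (centralOf a b c) :=
  ⟨dsCellRep a b c j h, (dsClsOfRecord_of_regular h j).symm, dsCellRep_package h j⟩

/-- **LAW «χ-pinned coh-unitary» for the table of record**: `dsCarriersOfRecord.LawChi`. [cite: Rogawski1990, §12.3 p. 177] [cite: BorelWallach2000, VI Thm. 4.12 (2)] -/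
theorem lawChi_dsCarriersOfRecord : dsCarriersOfRecord.LawChi :=
  fun _ _ _ h j => dsClsOfRecord_chi h j

end Summit.HodgeConjecture.HodgeConjecture.Cruxes.H413.K2E1bDSClsOfRecord

end
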